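import Mathlib
import Summits.KontsevichZagierPeriods.Zeta5Search.TypeSpaceLawZeroPointProof
import Summits.KontsevichZagierPeriods.Zeta5Search.VCarrierAggregate
import HarnessLib

/-!
# ζ(5) search — the V-HALF of the ZERO-POINT law as a stand-alone V-FLOOR: `‖V(b)‖_p ≤ p^{M−2}` (and for `b + e_j`), and the Casoratian with THEOREM LB's rows (DENOM-LAW D1, prover-d1 gen 20)

HONEST FRAMING: systematic search; no irrationality claim unless certified.  Cell `pub-zeta5`, track «DENOM-LAW» D1, seat `denom-prover-d1` gen 20
(`HOME/denom-law/prover-d1/ATTEMPT-20.md` §6).  `p`-adic valuations of the cell's OWN rationals (the constant-term coefficient `V(b) = coeffV b` and the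
contiguity Casoratian `Cas_j(b)`); nothing about ζ(5); no model exponent; records in print UNMOVED.

WHY.  The census of the ∀-`b` node after gen 20's corrections leaves a remainder that is, for 81 % of it (p = 11 sample), a pure V-FLOOR: THEOREM LB's
assembly with the TRUE valuation of `V(b)`, `V(b+e_j)` reaches the node.  The landed ZERO-POINT type-space law (`typeSpaceLawZeroPoint_of_residues`,
p3 gen 2) proves internally — and only internally — that under its hypotheses (every pole class `E ≥ −M`, the classes at `−M` centre-free with
palindromic type list, the residue congruences, all live doubled orbit points congruent mod `p`) the normalised constant terms `V(b)/(−p)^{−M}` and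
`V(b+e_j)/(−p)^{−M}` are `O(p²)`.  This file EXPORTS that V-half (`zeroPoint_vNorm_of_residues`, the tree's proof copied up to that point; `zeroPoint_vNorm`
with the degree condition discharging the residue congruences as in `typeSpaceLawZeroPoint_holds`), i.e. the V-floor `v_p(V) ≥ 2 − M` for `b` and `b + e_j`,
and feeds it to the V-input form of THEOREM LB (`VCarrier.cas_val_ge_of_coeffV`): **`cas_ge_of_zeroPointV`: `(2 − M) + r ≤ v_p(Cas_j(b))`** for any row constant
`r ≤ 1`, `r ≤ 3 + E_x` on multipole classes, `r ≤ 0` if `p > d`.  Where the multipole classes sit at `E ≥ −M + 3` this beats the zero-point law's own `7 − 2M`;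
as a census rung («ZV») it has 0 port violations on the exact tables and is mostly subsumed by the zero-point law anchored at the single-pole layer — its
point is the exported lemma, the first half of the successor's V-floor programme («VF2», sealed and hit 2,108/2,108, ATTEMPT-20 §6).
-/

noncomputable section

open Finset

namespace Summit.KontsevichZagierPeriods.Zeta5Search.SecondOrder

open Summit.KontsevichZagierPeriods.Zeta5Search.DualSeries (InBox)
open Summit.KontsevichZagierPeriods.Zeta5Search.WedgeDictionary (coeffW coeffV dOf)
open Summit.KontsevichZagierPeriods.Zeta5Search.CasoratianValuation (InPolytope shift casoratian)
open Summit.KontsevichZagierPeriods.Zeta5Search.ClusterValuation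
open Summit.KontsevichZagierPeriods.Zeta5Search.PadicSeries
open Summit.KontsevichZagierPeriods.Zeta5Search.BigPrime (shift_zero)
open Summit.KontsevichZagierPeriods.Zeta5Search.ResidueLaw (pointW pointV liveClasses res0_padicNorm_le sum_classExp_range)
open Summit.KontsevichZagierPeriods.Zeta5Search.BigPrime (dOf_shift)

variable {p : ℕ} [hp : Fact p.Prime]

/-- **The V-half of the zero-point law — conditional form**: under the class hypotheses of `TypeSpaceLawZeroPoint`, the residue congruences for `b` and
`b + e_j` and all live doubled orbit points congruent mod `p`, the normalised constant terms are `O(p²)`: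
`‖V(b)/(−p)^{−M}‖ ≤ p⁻²` and `‖V(b+e_j)/(−p)^{−M}‖ ≤ p⁻²`.  (The tree's `typeSpaceLawZeroPoint_of_residues`, its proof copied up to these two bounds.) -/
theorem zeroPoint_vNorm_of_residues (b : ℕ → ℤ) (p j M : ℕ) (hb : InPolytope b) (hb' : InPolytope (shift b j))
    (hj1 : 1 ≤ j) (hj7 : j ≤ 7) (hprime : p.Prime) (hp5 : 5 ≤ p) (hpb : (p : ℤ) ≤ b 0) (hwin : (b 0 + 2 : ℤ) < (p : ℤ) ^ 2)
    (hM : 6 ≤ M) (hMe : Even M)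
    (G1 : ∀ x, x < p → 1 ≤ classPoleCount b p x → -(M : ℤ) ≤ classExp b p x)
    (G3 : ∀ x, x < p → 1 ≤ classPoleCount b p x → classExp b p x = -(M : ℤ) →
      ¬ CentreIn b p x ∧ (classTypeList b p x).reverse = classTypeList b p x)
    (HP : ∀ x ∈ liveClasses b p M, ∀ y ∈ liveClasses b p M,
        (pointW b p M y - pointW b p M x = 0 ∨ 1 ≤ padicValRat p (pointW b p M y - pointW b p M x)) ∧
        (pointV b p M y - pointV b p M x = 0 ∨ 1 ≤ padicValRat p (pointV b p M y - pointV b p M x)))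
    (hres : padicNorm p
      ((∑ z ∈ (range p).filter (fun x => 1 ≤ classPoleCount b p x ∧ classExp b p x = -(M : ℤ)), gHat b p z * phiHat b p z)
        + ∑ z ∈ (range p).filter (fun x => 1 ≤ classPoleCount b p x ∧ classExp b p x = -(M : ℤ) + 1), gHat b p z)
      ≤ (p : ℚ) ^ (-(1 : ℤ)))
    (hres' : padicNorm p
      ((∑ z ∈ (range p).filter (fun x => 1 ≤ classPoleCount (shift b j) p x ∧ classExp (shift b j) p x = -(M : ℤ)),
          gHat (shift b j) p z * phiHat (shift b j) p z)
        + ∑ z ∈ (range p).filter (fun x => 1 ≤ classPoleCount (shift b j) p x ∧ classExp (shift b j) p x = -(M : ℤ) + 1),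
          gHat (shift b j) p z)
      ≤ (p : ℚ) ^ (-(1 : ℤ))) :
    padicNorm p (coeffV b / (-(p : ℚ)) ^ (-(M : ℤ))) ≤ (p : ℚ) ^ (-(2 : ℤ)) ∧
      padicNorm p (coeffV (shift b j) / (-(p : ℚ)) ^ (-(M : ℤ))) ≤ (p : ℚ) ^ (-(2 : ℤ)) := by
  haveI : Fact p.Prime := ⟨hprime⟩
  have hp0 : (p : ℚ) ≠ 0 := Nat.cast_ne_zero.2 hprime.ne_zero
  have hpneg : (-(p : ℚ)) ≠ 0 := neg_ne_zero.2 hp0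
  have hp2 : p ≠ 2 := by omega
  have h0 : 0 ≤ b 0 := hb.1.1
  obtain ⟨-, -, -, hn⟩ := thmA_data b hb hwin
  have h4n : padicNorm p (4 : ℚ) = 1 := by
    rw [show (4 : ℚ) = 2 * 2 by norm_num, padicNorm.mul, padicNorm_two hp2, one_mul]
  -- the aggregates for `b` and `b + e_j`
  obtain ⟨X, Y, k, -, hY1, -, hV, hk1, hkL, hksum, -, hYa⟩ := aggregate₃ b hb hp5 hpb hwin hM hMe G1 G3
  have hpb' : (p : ℤ) ≤ shift b j 0 := by rw [shift_zero b hj1]; exact hpb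
  have hwin' : (shift b j 0 + 2 : ℤ) < (p : ℤ) ^ 2 := by rw [shift_zero b hj1]; exact hwin
  obtain ⟨X', Y', k', -, hY1', -, hV', hk1', hkL', hksum', -, hYa'⟩ := aggregate₃ (shift b j) hb' hp5 hpb' hwin' hM hMe
    (G1_shift b hb hj1 G1) (G3_shift b hb hb' hj1 hj7 hpb G1 G3)
  have hPt : ∀ z, k' z ≠ 0 → z ∈ liveClasses b p M ∧ pointW (shift b j) p M z = pointW b p M z ∧
      pointV (shift b j) p M z = pointV b p M z := fun z hz =>
    point_transfer b hb hb' hj1 hj7 hpb hM hMe G1 G3 (hkL' z hz)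
  -- a base point
  obtain ⟨x₀, hx₀⟩ : ∃ x₀, ∀ z ∈ liveClasses b p M, x₀ ∈ liveClasses b p M := by
    by_cases h : (liveClasses b p M).Nonempty
    · obtain ⟨x, hx⟩ := h; exact ⟨x, fun _ _ => hx⟩
    · exact ⟨0, fun z hz => absurd ⟨z, hz⟩ h⟩
  have hP0 := padicNorm_point_le_one b h0 hn hp2 M x₀
  -- the weight sums are `O(p)`
  have hsum : padicNorm p (∑ z ∈ range p, k z) ≤ (p : ℚ) ^ (-(1 : ℤ)) := by
    have e : ∑ z ∈ range p, k z = (4 * ∑ z ∈ range p, k z) / 4 := by ring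
    rw [e, padicNorm.div, h4n, div_one, hksum]; exact hres
  have hsum' : padicNorm p (∑ z ∈ range p, k' z) ≤ (p : ℚ) ^ (-(1 : ℤ)) := by
    have e : ∑ z ∈ range p, k' z = (4 * ∑ z ∈ range p, k' z) / 4 := by ring
    rw [e, padicNorm.div, h4n, div_one, hksum']; exact hres'
  -- all points equal mod `p` ⇒ the aggregates vanish mod `p`
  have hYp : padicNorm p Y ≤ (p : ℚ) ^ (-(1 : ℤ)) :=
    norm_le_of_equal_points hYa hsum hk1 hP0.2 fun z hz =>
      padicNorm_le_of_zero_or_val (HP x₀ (hx₀ z (hkL z hz)) z (hkL z hz)).2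
  have hYp' : padicNorm p Y' ≤ (p : ℚ) ^ (-(1 : ℤ)) :=
    norm_le_of_equal_points hYa' hsum' hk1' hP0.2 fun z hz => by
      obtain ⟨hzL, -, hPV⟩ := hPt z hz
      rw [hPV]
      exact padicNorm_le_of_zero_or_val (HP x₀ (hx₀ z hzL) z hzL).2
  -- ### the normalised forms are `O(p²)`
  set v := coeffV b / (-(p : ℚ)) ^ (-(M : ℤ))
  set v' := coeffV (shift b j) / (-(p : ℚ)) ^ (-(M : ℤ))
  have hv := norm_le_two_of_X hV hYp
  have hv' := norm_le_two_of_X hV' hYp'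
  exact ⟨hv, hv'⟩

/-- **The zero-point V-FLOOR**: under `TypeSpaceLawZeroPoint`'s hypotheses (degree condition `p(M−2) + ΣE_x ≤ −4`), `‖V(b)‖ ≤ p^{−(2−M)}` and
`‖V(b+e_j)‖ ≤ p^{−(2−M)}`, i.e. `v_p(V) ≥ 2 − M` for both constant terms. -/
theorem zeroPoint_vNorm (b : ℕ → ℤ) (p j M : ℕ) (hb : InPolytope b) (hb' : InPolytope (shift b j))
    (hj1 : 1 ≤ j) (hj7 : j ≤ 7) (hprime : p.Prime) (hp5 : 5 ≤ p) (hpb : (p : ℤ) ≤ b 0) (hwin : (b 0 + 2 : ℤ) < (p : ℤ) ^ 2)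
    (hM : 6 ≤ M) (hMe : Even M)
    (G1 : ∀ x, x < p → 1 ≤ classPoleCount b p x → -(M : ℤ) ≤ classExp b p x)
    (G3 : ∀ x, x < p → 1 ≤ classPoleCount b p x → classExp b p x = -(M : ℤ) →
      ¬ CentreIn b p x ∧ (classTypeList b p x).reverse = classTypeList b p x)
    (hdeg : (p : ℤ) * ((M : ℤ) - 2) + ∑ x ∈ range p, classExp b p x ≤ -4)
    (HP : ∀ x ∈ liveClasses b p M, ∀ y ∈ liveClasses b p M,
        (pointW b p M y - pointW b p M x = 0 ∨ 1 ≤ padicValRat p (pointW b p M y - pointW b p M x)) ∧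
        (pointV b p M y - pointV b p M x = 0 ∨ 1 ≤ padicValRat p (pointV b p M y - pointV b p M x))) :
    padicNorm p (coeffV b) ≤ (p : ℚ) ^ (-((2 : ℤ) - M)) ∧ padicNorm p (coeffV (shift b j)) ≤ (p : ℚ) ^ (-((2 : ℤ) - M)) := by
  haveI : Fact p.Prime := ⟨hprime⟩
  have hp0 : (p : ℚ) ≠ 0 := Nat.cast_ne_zero.2 hprime.ne_zero
  have hpneg : (-(p : ℚ)) ≠ 0 := neg_ne_zero.2 hp0
  have hdegb : (p : ℤ) * ((M : ℤ) - 2) + ∑ x ∈ range p, classExp b p x ≤ -2 := by omega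
  have hsum : ∑ x ∈ range p, classExp (shift b j) p x = ∑ x ∈ range p, classExp b p x + 2 := by
    rw [sum_classExp_range (shift b j) hb' hp5, sum_classExp_range b hb hp5, dOf_shift b hj1 hj7]
    ring
  have hdeg' : (p : ℤ) * ((M : ℤ) - 2) + ∑ x ∈ range p, classExp (shift b j) p x ≤ -2 := by omega
  have hpb' : (p : ℤ) ≤ shift b j 0 := by rw [shift_zero b hj1]; exact hpb
  obtain ⟨hv, hv'⟩ := zeroPoint_vNorm_of_residues b p j M hb hb' hj1 hj7 hprime hp5 hpb hwin hM hMe G1 G3 HP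
    (res0_padicNorm_le b M hb hp5 hpb (by omega) G1 hdegb)
    (res0_padicNorm_le (shift b j) M hb' hp5 hpb' (by omega) (G1_shift b hb hj1 G1) hdeg')
  have conv : ∀ {V : ℚ}, padicNorm p (V / (-(p : ℚ)) ^ (-(M : ℤ))) ≤ (p : ℚ) ^ (-(2 : ℤ)) →
      padicNorm p V ≤ (p : ℚ) ^ (-((2 : ℤ) - M)) := by
    intro V h
    have e : V = V / (-(p : ℚ)) ^ (-(M : ℤ)) * (-(p : ℚ)) ^ (-(M : ℤ)) := by rw [div_mul_cancel₀ _ (zpow_ne_zero _ hpneg)]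
    rw [e, padicNorm.mul, LevelClass.padicNorm_neg_p_zpow]
    calc padicNorm p (V / (-(p : ℚ)) ^ (-(M : ℤ))) * (p : ℚ) ^ (-(-(M : ℤ)))
        ≤ (p : ℚ) ^ (-(2 : ℤ)) * (p : ℚ) ^ (-(-(M : ℤ))) := mul_le_mul_of_nonneg_right h (zpow_p_nonneg _)
      _ = (p : ℚ) ^ (-((2 : ℤ) - M)) := by rw [← zpow_add₀ hp0]; congr 1; ring
  exact ⟨conv hv, conv hv'⟩

/-- **The Casoratian from the zero-point V-floor and THEOREM LB's rows**: under `TypeSpaceLawZeroPoint`'s hypotheses and a row constant `r` with `r ≤ 1`,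
`r ≤ 3 + E_x` on every multipole class and `r ≤ 0` unless `p ≤ d`, `(2 − M) + r ≤ v_p(Cas_j(b))` (`VCarrier.cas_val_ge_of_coeffV`). -/
theorem cas_ge_of_zeroPointV (b : ℕ → ℤ) (p j M : ℕ) (hb : InPolytope b) (hb' : InPolytope (shift b j))
    (hj1 : 1 ≤ j) (hj7 : j ≤ 7) (hprime : p.Prime) (hp5 : 5 ≤ p) (hpb : (p : ℤ) ≤ b 0) (hwin : (b 0 + 2 : ℤ) < (p : ℤ) ^ 2)
    (hM : 6 ≤ M) (hMe : Even M)
    (G1 : ∀ x, x < p → 1 ≤ classPoleCount b p x → -(M : ℤ) ≤ classExp b p x)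
    (G3 : ∀ x, x < p → 1 ≤ classPoleCount b p x → classExp b p x = -(M : ℤ) →
      ¬ CentreIn b p x ∧ (classTypeList b p x).reverse = classTypeList b p x)
    (hdeg : (p : ℤ) * ((M : ℤ) - 2) + ∑ x ∈ range p, classExp b p x ≤ -4)
    (HP : ∀ x ∈ liveClasses b p M, ∀ y ∈ liveClasses b p M,
        (pointW b p M y - pointW b p M x = 0 ∨ 1 ≤ padicValRat p (pointW b p M y - pointW b p M x)) ∧
        (pointV b p M y - pointV b p M x = 0 ∨ 1 ≤ padicValRat p (pointV b p M y - pointV b p M x)))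
    (r : ℤ) (hr1 : r ≤ 1) (hrm : ∀ x, x < p → 2 ≤ classPoleCount b p x → r ≤ 3 + classExp b p x)
    (hr0 : dOf b < (p : ℤ) → r ≤ 0) (hcas : casoratian b j ≠ 0) :
    (2 - (M : ℤ)) + r ≤ padicValRat p (casoratian b j) := by
  haveI : Fact p.Prime := ⟨hprime⟩
  obtain ⟨hV, hV'⟩ := zeroPoint_vNorm b p j M hb hb' hj1 hj7 hprime hp5 hpb hwin hM hMe G1 G3 hdeg HP
  exact VCarrier.cas_val_ge_of_coeffV b hb hj1 hj7 hb' hp5 hwin ((2 : ℤ) - M) r hV hV' hr1 hrm hr0 hcas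

end Summit.KontsevichZagierPeriods.Zeta5Search.SecondOrder

end
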